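import Literature.NumberTheory.ComplexMultiplication.EllipticUnits.ThetaSingularValues
import Literature.NumberTheory.EllipticCurves.RealLatticePeriod
import Mathlib.NumberTheory.LegendreSymbol.JacobiSymbol
import HarnessLib

/-!
# Monsky 1990, §1–§2: the level-`8` modular functions `X` (= Weber's `𝔣₁⁶/2√2`) and `Y`, the identity
# `2Y² = X⁴ + 1`, and SHIMURA RECIPROCITY for their singular values at `ω = i√(2D)` (Thms. 1.5, 2.3, 2.4)

Topic `Literature/NumberTheory/EllipticCurves/Monsky1990` (the existing directory of P. Monsky, *Mock Heegner
points and congruent numbers*, Math. Z. 204 (1990) 45–67 [Monsky1990MockHeegner]; siblings: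
`MockHeegnerCongruentNumbers` = Cor. 5.15, `DescentLemma*` = Lemmas 5.4/5.8 PROVED, `GenusClassGroupFacts` =
the genus theory of p. 52, `GenusFieldGaloisData`, `RemarkThreeExampleFamily`; nothing of them is
re-declared). Cell `bsd-print-cf2`, typer seat `-ty2` g47, typer input **(U2)** of crux
`stmt-BirchSwinnertonDyer-20509`, line `offtyz-v7` (LEAD memo `Cruxes/RamifiedOffTYZOfFacts/Lines/
offtyz_v7_RigidityAndUnits.md` §4(e)/§4ter: «(U2) = Shimura reciprocity for `𝔣, 𝔣₁, 𝔣₂` at `16τ_n`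
(Gee–Stevenhagen style)»; Monsky's `X` IS Weber's `𝔣₁⁶/(2√2)`, p. 47). ONE source section — Monsky 1990
**§1 "The modular functions X and Y" (pp. 47–48) and §2 "The points P_𝒜" up to Thm. 2.4 (pp. 48–50)** —
typed statements-first (D-0064): DEFINITIONS with bodies (`e_{u,v}`, `E₁,…,E₆`, `X`, `Y`, the CM points
`ω`, `η`) and TWO NAMED FACTS (`def … : Prop`, D-0014, nothing asserted): Thm. 1.5 and Thms. 2.3–2.4.
Text of record: the verbatim transcription FROM THE PAGE IMAGES (GDZ PPN266833020_0204, journal pp. 45–67)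
`run/shared/lean/pub/bsd-monsky/lit/monsky1990/MONSKY1990-STATEMENTS.md` (bsd-monsky-lit, 2026-08-25; images
`img/p47.jpg`–`p50.jpg`); the journal PDF itself is acquisition `acq-09908`/`acq-10926` (open). HONEST
FRAMING: nothing here proves anything about BSD; no `_holds`. §4 of this file (appended by the same seat)
types the rest of §2 — the points `P_𝒜` on `C : 2Y² = X⁴ + 1` (Def. 2.1, 2.5, 2.7, 2.9) and Thms. 2.8/2.11
(Lemmas 2.6/2.10) — as ONE further named fact plus consequences PROVED from Thm. 2.4; §§3–5 (`S_N`, `Λ_N`,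
Thms. 5.13/5.14) are NOT typed here (the bsd-monsky cell carries their CONTENT through `φ : C ≅ E` as
displays, e.g. `Tian2014.CMPointSystemMonskyDescent`, and Cor. 5.15 / Remark (2) as `Monsky1990.cor515_…`).

## The printed statements (verbatim; «p. NN» = journal page)

* **Def. 1.1** (p. 47). «Suppose `u, v ∈ ℤ/8` and are not both zero. If `z ∈ ℂ` with `Im z > 0` let `L` be
  the lattice spanned by `1` and `z`, and let `℘_L` be the associated Weierstrass ℘-function. Then
  `e_{u,v}(z) = ℘_L((uz + v)/8)`.» «Note that `e_{u,v} = e_{−u,−v}`. Furthermore if `(a b; c d)` is in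
  `SL₂(ℤ)` then `e_{u,v}((az + b)/(cz + d)) = (cz + d)² e_{au+cv, bu+dv}(z)`.»
* **Def. 1.2.** «(1) `E₁ = e_{0,4} − e_{4,0}`, `E₂ = e_{4,4} − e_{4,0}`, `E₃ = E₁ − E₂ = e_{0,4} − e_{4,4}`.
  (2) `E₄ = e_{1,0} + e_{1,4} − e_{5,0} − e_{5,4}`, `E₅ = e_{1,6} + e_{3,6} − e_{5,6} − e_{7,6}`.
  (3) `E₆ = e_{2,4} − e_{2,0}`.»
* **Def. 1.4.** «`X` is the modular function `(i/16√2)(E₄E₅/E₁E₂)` of level `8`. `Y` is the modular function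
  `(1/√2)((E₁ + E₂)/E₆)` of level `4`.» (p. 47: «what we shall call `X` is Weber's `(1/2√2)·𝔣₁⁶`.»)
* **Thm. 1.5** (p. 47). «(1) `X` and `Y` are holomorphic in the upper half plane and `X` has no zeros there.
  (2) `X` and `Y` take positive values on `iℝ⁺`. (3) `2Y² = X⁴ + 1`. (4) `X(−2/λ) = X(λ)⁻¹`;
  `Y(−2/λ) = Y(λ)·(X(λ))⁻²`.» [proof pp. 47–48: `X⁴ = E₃²/4E₁E₂ = Δ(z/2)/64Δ(z)` — not a clause below.]
* **Def. 2.2** (p. 48). «`D` is a positive odd square free integer, `ω = i√(2D)`, `K = ℚ(ω)` and `H` is the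
  Hilbert class-field of `K`.»
* **Thm. 2.3** (p. 49). «If `D ≡ 1 (4)`, `x = X(ω)` and `y = Y(ω)` lie in `H`, while if `D ≡ 3 (4)`, `x` and
  `iy` are in `H`.»
* **Thm. 2.4** (p. 49). «Let `𝒜` be an ideal class of `ℤ[ω]` and `I` an element of `𝒜` of odd norm. Choose a
  `ℤ`-basis `{aω + b, d}` of `I` with `b ≡ 0 (8)` and `ad > 0`, and set `η = (aω + b)/d`. Let `σ_𝒜` be the
  Artin automorphism of `H/K` attached to `𝒜`. Then `σ_𝒜⁻¹(x) = (2/𝔑I)·X(η)`. If `D ≡ 1 (4)`,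
  `σ_𝒜⁻¹(y) = (2/𝔑I)·Y(η)` while if `D ≡ 3 (4)`, `σ_𝒜⁻¹(iy) = (−2/𝔑I)·iY(η)`.» [«`(2/𝔑I)`, `(−2/𝔑I)` =
  Jacobi symbols in the norm of `I`»; proof pp. 49–50 by Shimura reciprocity [8, Prop. 6.34].]

## Transcription (word → tree object)

* `z ∈ ℍ` is Mathlib's `UpperHalfPlane`; «the lattice spanned by `1` and `z`» is the tree's
  `PeriodPair.ofUpperHalfPlane z` (`RealLatticePeriod.lean`), `℘_L` Mathlib's `PeriodPair.weierstrassP`;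
  `u, v ∈ ℤ/8` are `ZMod 8`, read through their representatives `0 ≤ val < 8` (the value of
  `℘_L((uz+v)/8)` only depends on `(u, v) mod 8` by `L`-periodicity — printed «Note that…»).
* `X`, `Y` are functions `ℍ → ℂ` with the printed constants `i/(16√2)`, `1/√2` (`Real.sqrt 2`).
* «`−2/λ`» is the point `negTwoDiv λ ∈ ℍ` (`Im(−2/λ) = 2 Im λ/|λ|² > 0`).
* «`ω = i√(2D)`» is `omegaPt D ∈ ℍ`; «`η = (aω + b)/d`» is `etaPt D a b d ∈ ℍ` (`ad > 0`).
* «`K = ℚ(ω)`, `H`, `σ_𝒜`» — as in the tree's CM files (`ThetaSingularValues`): `K` an imaginary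
  quadratic field with an embedding `ι : K →+* ℂ` and an element `w ∈ 𝓞_K` with `ι w = i√(2D)` (then
  `K = ℚ(w)` and, `2D` being square-free `≡ 2 (mod 4)`, `𝓞_K = ℤ[w]` = Monsky's `ℤ[ω]`, so «ideal class of
  `ℤ[ω]`» = class of an ideal `I` of `𝓞 K`); `H = K(1) = rayClassField K ⊤ ⊆ K̄` with the fixed extension
  `ι̂ = algClosureEmb ι : K̄ → ℂ`; «`x ∈ H`» is `∃ x' ∈ K(1), ι̂ x' = X(ω)`; «`σ_𝒜`» is the Artin symbol
  `artinSymbol (galFrob K K(1)) I` of a representative `I ∈ 𝒜` (the tree's arithmetic Frobenii, as in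
  `DeShalit1987.prop24_ii_galoisAction`); «`ℤ`-basis `{aω + b, d}` of `I`» is `IsZBasis w I a b d`; «odd norm»
  is `Odd (Ideal.absNorm I)`; «`(2/𝔑I)`» is Mathlib's `jacobiSym 2 (Ideal.absNorm I)`.
-- TODO(general form): Monsky's e_{u,v} transformation law under SL₂(ℤ) and Lemma 1.3 (divisors of
-- E₃²/E₁E₂, E₆²/E₁E₂, E₄E₅/E₁E₂ on C(2), C(4), C(8)) are not typed; the projective curve C with its group
-- law (Def. 2.1) is not constructed — only the four printed self-maps, in coordinates (§4); §§3–5 are left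
-- to the bsd-monsky displays.

## References

* [Monsky1990MockHeegner] P. Monsky, Mock Heegner points and congruent numbers, Math. Z. 204 (1990) 45–67:
  Def. 1.1, 1.2, 1.4, Thm. 1.5 (p. 47), Def. 2.1, 2.2 (p. 48), Thm. 2.3, Thm. 2.4 (p. 49), Def. 2.5,
  Lemma 2.6, Def. 2.7, Thm. 2.8 (p. 50), Def. 2.9, Lemma 2.10, Thm. 2.11 (p. 51).
* G. Shimura, *Introduction to the arithmetic theory of automorphic functions* (1971), Prop. 6.34 (p. 161)
  — Monsky's [8], the reciprocity law used in the proof (not restated; cf. the tree's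
  `Literature.NumberTheory.ComplexMultiplication.ShimuraReciprocityFrobenius`).
* S. Lang, *Elliptic Functions*, 2nd ed. (1987), Ch. 11 (Shimura reciprocity), Ch. 12 §1 (Weber functions)
  [Lang1987].
-/

noncomputable section

open Complex
open UpperHalfPlane hiding I
open scoped Real NumberTheorySymbols Manifold

namespace Literature.NumberTheory.EllipticCurves.Monsky1990

/-! ## §1 The modular functions `e_{u,v}`, `E₁, …, E₆`, `X`, `Y` (Monsky Def. 1.1, 1.2, 1.4) -/

/-- **Monsky's `e_{u,v}(z) = ℘_L((uz + v)/8)`**, `L = ℤz + ℤ`, for `u, v ∈ ℤ/8` (read through the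
representatives `0 ≤ u, v < 8`; the value is independent of the representatives by periodicity).
[cite: Monsky1990MockHeegner, Def. 1.1 (p. 47)] -/
def eUV (u v : ZMod 8) (z : ℍ) : ℂ :=
  (PeriodPair.ofUpperHalfPlane z).weierstrassP ((((u.val : ℕ) : ℂ) * (z : ℂ) + ((v.val : ℕ) : ℂ)) / 8)

/-- `E₁ = e_{0,4} − e_{4,0}`. [cite: Monsky1990MockHeegner, Def. 1.2 (1) (p. 47)] -/
def E₁ (z : ℍ) : ℂ := eUV 0 4 z - eUV 4 0 z

/-- `E₂ = e_{4,4} − e_{4,0}`. [cite: Monsky1990MockHeegner, Def. 1.2 (1) (p. 47)] -/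
def E₂ (z : ℍ) : ℂ := eUV 4 4 z - eUV 4 0 z

/-- `E₃ = E₁ − E₂ = e_{0,4} − e_{4,4}`. [cite: Monsky1990MockHeegner, Def. 1.2 (1) (p. 47)] -/
def E₃ (z : ℍ) : ℂ := E₁ z - E₂ z

/-- `E₄ = e_{1,0} + e_{1,4} − e_{5,0} − e_{5,4}`. [cite: Monsky1990MockHeegner, Def. 1.2 (2) (p. 47)] -/
def E₄ (z : ℍ) : ℂ := eUV 1 0 z + eUV 1 4 z - eUV 5 0 z - eUV 5 4 z

/-- `E₅ = e_{1,6} + e_{3,6} − e_{5,6} − e_{7,6}`. [cite: Monsky1990MockHeegner, Def. 1.2 (2) (p. 47)] -/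
def E₅ (z : ℍ) : ℂ := eUV 1 6 z + eUV 3 6 z - eUV 5 6 z - eUV 7 6 z

/-- `E₆ = e_{2,4} − e_{2,0}`. [cite: Monsky1990MockHeegner, Def. 1.2 (3) (p. 47)] -/
def E₆ (z : ℍ) : ℂ := eUV 2 4 z - eUV 2 0 z

/-- **Monsky's `X = (i/16√2)·E₄E₅/(E₁E₂)`**, a modular function of level `8` («what we shall call `X` is
Weber's `(1/2√2)·𝔣₁⁶`»). [cite: Monsky1990MockHeegner, Def. 1.4 (p. 47)] -/
def X (z : ℍ) : ℂ := I / (16 * (Real.sqrt 2 : ℂ)) * (E₄ z * E₅ z / (E₁ z * E₂ z))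

/-- **Monsky's `Y = (1/√2)·(E₁ + E₂)/E₆`**, a modular function of level `4`. [cite: Monsky1990MockHeegner, Def. 1.4 (p. 47)] -/
def Y (z : ℍ) : ℂ := 1 / (Real.sqrt 2 : ℂ) * ((E₁ z + E₂ z) / E₆ z)

/-- `E₃ = e_{0,4} − e_{4,4}` (the second printed form). [cite: Monsky1990MockHeegner, Def. 1.2 (1) (p. 47)] -/
theorem E₃_eq (z : ℍ) : E₃ z = eUV 0 4 z - eUV 4 4 z := by
  simp only [E₃, E₁, E₂]; ring

/-- The point `−2/λ ∈ ℍ` of Thm. 1.5 (4) (`Im(−2/λ) = 2·Im λ/|λ|² > 0`). [cite: Monsky1990MockHeegner, Thm. 1.5 (4) (p. 47)] -/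
def negTwoDiv (z : ℍ) : ℍ :=
  ⟨-2 / (z : ℂ), by
    rw [Complex.div_im]
    have h0 : (0 : ℝ) < Complex.normSq (z : ℂ) := Complex.normSq_pos.mpr z.ne_zero
    have hz : 0 < (z : ℂ).im := z.im_pos
    have : (-2 : ℂ).im = 0 := by norm_num
    have h2 : (-2 : ℂ).re = -2 := by norm_num
    rw [this, h2, zero_mul, zero_div, zero_sub, neg_mul, neg_div, neg_neg]
    positivity⟩

/-- Unfolding `negTwoDiv`. [cite: Monsky1990MockHeegner, Thm. 1.5 (4) (p. 47)] -/
@[simp]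
theorem coe_negTwoDiv (z : ℍ) : ((negTwoDiv z : ℍ) : ℂ) = -2 / (z : ℂ) := rfl

/-- The point `it ∈ ℍ` of the positive imaginary axis (`t > 0`). [cite: Monsky1990MockHeegner, Thm. 1.5 (2) (p. 47: «iℝ⁺»)] -/
def imagAxisPt (t : ℝ) (ht : 0 < t) : ℍ := ⟨I * t, by simpa using ht⟩

/-- Unfolding `imagAxisPt`. [cite: Monsky1990MockHeegner, Thm. 1.5 (2) (p. 47)] -/
@[simp]
theorem coe_imagAxisPt (t : ℝ) (ht : 0 < t) : ((imagAxisPt t ht : ℍ) : ℂ) = I * t := rfl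

/-! ## §2 The named fact: Theorem 1.5 -/

/-- **Monsky 1990, Thm. 1.5** (p. 47): «(1) `X` and `Y` are holomorphic in the upper half plane and `X` has no
zeros there. (2) `X` and `Y` take positive values on `iℝ⁺`. (3) `2Y² = X⁴ + 1`. (4) `X(−2/λ) = X(λ)⁻¹`;
`Y(−2/λ) = Y(λ)·(X(λ))⁻²`.» Transcribed: (1) holomorphy as `MDifferentiable` on `ℍ` and `X z ≠ 0`;
(2) for `t > 0`, `X(it)` and `Y(it)` are real and positive; (3), (4) as printed, for every `λ ∈ ℍ`. Named fact;
nothing asserted (the proof, pp. 47–48, goes through `X⁴ = E₃²/4E₁E₂ = Δ(z/2)/64Δ(z)` and Lemma 1.3).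
[cite: Monsky1990MockHeegner, Thm. 1.5 (p. 47)] -/
def thm15_XY : Prop :=
  (MDifferentiable 𝓘(ℂ) 𝓘(ℂ) X ∧ MDifferentiable 𝓘(ℂ) 𝓘(ℂ) Y ∧ ∀ z : ℍ, X z ≠ 0) ∧
  (∀ (t : ℝ) (ht : 0 < t), (∃ r : ℝ, 0 < r ∧ X (imagAxisPt t ht) = r) ∧
    ∃ r : ℝ, 0 < r ∧ Y (imagAxisPt t ht) = r) ∧
  (∀ z : ℍ, 2 * Y z ^ 2 = X z ^ 4 + 1) ∧
  (∀ z : ℍ, X (negTwoDiv z) = (X z)⁻¹ ∧ Y (negTwoDiv z) = Y z * (X z)⁻¹ ^ 2)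

/-- From Thm. 1.5 (3)–(4): at `λ` and `−2/λ` the pair `(X, Y)` satisfies `(x, y) ↦ (x⁻¹, yx⁻²)` — on the
curve `C : 2Y² = X⁴ + 1` this is the map that Def. 2.1 identifies with multiplication by `−1` (origin `(1,1)`).
PROVED from the fact (no new content). [cite: Monsky1990MockHeegner, Thm. 1.5 (3), (4) (p. 47); Def. 2.1 (p. 48)] -/
theorem thm15_XY.curve_negTwoDiv (h : thm15_XY) (z : ℍ) :
    2 * Y (negTwoDiv z) ^ 2 = X (negTwoDiv z) ^ 4 + 1 ∧ X (negTwoDiv z) * X z = 1 := by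
  obtain ⟨⟨-, -, hX0⟩, -, h3, h4⟩ := h
  refine ⟨h3 _, ?_⟩
  rw [(h4 z).1, inv_mul_cancel₀ (hX0 z)]

/-! ## §3 The CM points `ω = i√(2D)`, `η = (aω + b)/d`, and the named fact: Theorems 2.3–2.4 -/

/-- **`ω = i√(2D) ∈ ℍ`** (`D > 0`). [cite: Monsky1990MockHeegner, Def. 2.2 (p. 48)] -/
def omegaPt (D : ℕ) (hD : 0 < D) : ℍ :=
  ⟨I * (Real.sqrt (2 * D) : ℝ), by
    have : (0 : ℝ) < Real.sqrt (2 * D) := Real.sqrt_pos.mpr (by positivity)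
    simpa using this⟩

/-- Unfolding `omegaPt`. [cite: Monsky1990MockHeegner, Def. 2.2 (p. 48)] -/
@[simp]
theorem coe_omegaPt (D : ℕ) (hD : 0 < D) : ((omegaPt D hD : ℍ) : ℂ) = I * (Real.sqrt (2 * D) : ℝ) := rfl

/-- **`η = (aω + b)/d ∈ ℍ`** for integers `a, b, d` with `ad > 0` (`Im η = (a/d)√(2D) > 0`).
[cite: Monsky1990MockHeegner, Thm. 2.4 (p. 49: «set η = (aω + b)/d»)] -/
def etaPt (D : ℕ) (hD : 0 < D) (a b d : ℤ) (had : 0 < a * d) : ℍ :=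
  ⟨((a : ℂ) * (I * (Real.sqrt (2 * D) : ℝ)) + b) / d, by
    have hs : (0 : ℝ) < Real.sqrt (2 * D) := Real.sqrt_pos.mpr (by positivity)
    have hd : (d : ℝ) ≠ 0 := by
      have : d ≠ 0 := by rintro rfl; simp at had
      exact_mod_cast this
    have him : (((a : ℂ) * (I * (Real.sqrt (2 * D) : ℝ)) + b) / d).im = (a : ℝ) * Real.sqrt (2 * D) / d := by
      rw [show (d : ℂ) = ((d : ℝ) : ℂ) by norm_cast, Complex.div_ofReal_im]
      simp
    rw [him]
    have had' : (0 : ℝ) < a * d := by exact_mod_cast had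
    have : (0 : ℝ) < (a : ℝ) / d := by
      have hdd : (0:ℝ) < (d : ℝ) * d := mul_self_pos.mpr hd
      have : (a : ℝ) / d = (a * d) / (d * d) := by field_simp
      rw [this]; positivity
    calc (0 : ℝ) < (a : ℝ) / d * Real.sqrt (2 * D) := mul_pos this hs
      _ = (a : ℝ) * Real.sqrt (2 * D) / d := by ring⟩

/-- Unfolding `etaPt`. [cite: Monsky1990MockHeegner, Thm. 2.4 (p. 49)] -/
@[simp]
theorem coe_etaPt (D : ℕ) (hD : 0 < D) (a b d : ℤ) (had : 0 < a * d) :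
    ((etaPt D hD a b d had : ℍ) : ℂ) = ((a : ℂ) * (I * (Real.sqrt (2 * D) : ℝ)) + b) / d := rfl

section CM

open _root_.NumberField

variable {K : Type} [Field K]

/-- **«a `ℤ`-basis `{aω + b, d}` of `I`»**: the ideal `I` of `𝓞_K = ℤ[w]` is, inside `K`, exactly
`ℤ·(aw + b) + ℤ·d`. [cite: Monsky1990MockHeegner, Thm. 2.4 (p. 49)] -/
def IsZBasis (w : 𝓞 K) (I : Ideal (𝓞 K)) (a b d : ℤ) : Prop :=
  ∀ x : 𝓞 K, x ∈ I ↔ ∃ m n : ℤ, (x : K) = m * ((a : K) * (w : K) + b) + n * d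

/-- Unfolding `IsZBasis`. [cite: Monsky1990MockHeegner, Thm. 2.4 (p. 49)] -/
theorem isZBasis_iff (w : 𝓞 K) (I : Ideal (𝓞 K)) (a b d : ℤ) :
    IsZBasis w I a b d ↔
      ∀ x : 𝓞 K, x ∈ I ↔ ∃ m n : ℤ, (x : K) = m * ((a : K) * (w : K) + b) + n * d := Iff.rfl

end CM

section Fact

open _root_.NumberField
open Literature.NumberTheory.EllipticCurves (IsImaginaryQuadratic)
open Literature.NumberTheory.NumberFields (rayClassField)
open Literature.NumberTheory.GaloisRepresentations (galFrob)
open Literature.NumberTheory.LFunctions.AbelianDensity (artinSymbol)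
open Literature.NumberTheory.ComplexMultiplication.EllipticUnits (algClosureEmb)

/-- **Monsky 1990, Thms. 2.3 and 2.4 (p. 49) — the singular values `x = X(ω)`, `y = Y(ω)` at `ω = i√(2D)` lie
in the Hilbert class field `H` of `K = ℚ(ω)` (`iy` instead of `y` when `D ≡ 3 (4)`), and SHIMURA RECIPROCITY
for them: «Let `𝒜` be an ideal class of `ℤ[ω]` and `I` an element of `𝒜` of odd norm. Choose a `ℤ`-basis
`{aω + b, d}` of `I` with `b ≡ 0 (8)` and `ad > 0`, and set `η = (aω + b)/d`. Let `σ_𝒜` be the Artin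
automorphism of `H/K` attached to `𝒜`. Then `σ_𝒜⁻¹(x) = (2/𝔑I)·X(η)`. If `D ≡ 1 (4)`,
`σ_𝒜⁻¹(y) = (2/𝔑I)·Y(η)` while if `D ≡ 3 (4)`, `σ_𝒜⁻¹(iy) = (−2/𝔑I)·iY(η)`.»
Typed (see the module docstring for every identification): for `D` positive, odd, square-free; `K` imaginary
quadratic with `ι : K → ℂ` and `w ∈ 𝓞_K` with `ι w = i√(2D)`; `H = K(1) = rayClassField K ⊤`, `ι̂ =
algClosureEmb ι`; every ideal `I ≠ 0` of `𝓞_K` of odd norm with a `ℤ`-basis `{aw + b, d}`, `8 ∣ b`, `ad > 0`,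
and `σ = artinSymbol (galFrob K K(1)) I`:
(Thm 2.3 ∧ Thm 2.4 for `x`) there is `x' ∈ K(1)` with `ι̂ x' = X(ω)`, and every such `x'` has
`ι̂ (σ⁻¹ x') = (2/𝔑I)·X(η)`; (`D ≡ 1 (4)`) there is `y' ∈ K(1)` with `ι̂ y' = Y(ω)`, and every such `y'` has
`ι̂ (σ⁻¹ y') = (2/𝔑I)·Y(η)`; (`D ≡ 3 (4)`) there is `y' ∈ K(1)` with `ι̂ y' = i·Y(ω)`, and every such `y'` has
`ι̂ (σ⁻¹ y') = (−2/𝔑I)·i·Y(η)`. Named fact; nothing asserted (proof pp. 49–50: Fricke functions of level `8`,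
Shimura reciprocity [8, Prop. 6.34]). [cite: Monsky1990MockHeegner, Thm. 2.3 and Thm. 2.4 (p. 49), Def. 2.2 (p. 48)] -/
def thm23_thm24_singularValues : Prop :=
  ∀ (D : ℕ) (hD : 0 < D), Odd D → Squarefree D →
  ∀ (K : Type) [Field K] [NumberField K], IsImaginaryQuadratic K → ∀ (ι : K →+* ℂ) (w : 𝓞 K),
    ι (w : K) = I * (Real.sqrt (2 * D) : ℝ) →
  ∀ (I₀ : Ideal (𝓞 K)), I₀ ≠ ⊥ → Odd (Ideal.absNorm I₀) →
  ∀ (a b d : ℤ) (had : 0 < a * d), (8 : ℤ) ∣ b → IsZBasis w I₀ a b d →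
    -- Thm 2.3 + Thm 2.4 for `x = X(ω)` (both residues of `D` mod `4`)
    ((∃ x' : rayClassField K ⊤, algClosureEmb ι x' = X (omegaPt D hD)) ∧
      ∀ x' : rayClassField K ⊤, algClosureEmb ι x' = X (omegaPt D hD) →
        algClosureEmb ι ((artinSymbol (galFrob K (rayClassField K ⊤)) I₀)⁻¹ x') =
          (J(2 | Ideal.absNorm I₀) : ℂ) * X (etaPt D hD a b d had)) ∧
    -- `D ≡ 1 (mod 4)`: `y = Y(ω) ∈ H` and `σ_𝒜⁻¹(y) = (2/𝔑I)·Y(η)`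
    (D % 4 = 1 →
      (∃ y' : rayClassField K ⊤, algClosureEmb ι y' = Y (omegaPt D hD)) ∧
      ∀ y' : rayClassField K ⊤, algClosureEmb ι y' = Y (omegaPt D hD) →
        algClosureEmb ι ((artinSymbol (galFrob K (rayClassField K ⊤)) I₀)⁻¹ y') =
          (J(2 | Ideal.absNorm I₀) : ℂ) * Y (etaPt D hD a b d had)) ∧
    -- `D ≡ 3 (mod 4)`: `iy ∈ H` and `σ_𝒜⁻¹(iy) = (−2/𝔑I)·iY(η)`
    (D % 4 = 3 →
      (∃ y' : rayClassField K ⊤, algClosureEmb ι y' = I * Y (omegaPt D hD)) ∧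
      ∀ y' : rayClassField K ⊤, algClosureEmb ι y' = I * Y (omegaPt D hD) →
        algClosureEmb ι ((artinSymbol (galFrob K (rayClassField K ⊤)) I₀)⁻¹ y') =
          (J(-2 | Ideal.absNorm I₀) : ℂ) * (I * Y (etaPt D hD a b d had)))

/-- **Thm. 2.4 at the principal class** (`I = 𝓞_K = (1)`, `ℤ`-basis `{ω, 1}`: `a = 1, b = 0, d = 1`,
`η = ω`, `𝔑I = 1`, `(2/1) = 1`, `σ_{(1)} = 1`): the fact then just says `x ∈ H` (Thm. 2.3) — the reading at
`𝒜 = 1` is consistent (`X(η) = X(ω)`). Recorded as the trivial consequence «`ι̂ x' = X(ω)` for some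
`x' ∈ K(1)`», PROVED from the fact given a `ℤ`-basis witness for `(1)`. [cite: Monsky1990MockHeegner, Thm. 2.3 (p. 49)] -/
theorem thm23_thm24_singularValues.x_mem (h : thm23_thm24_singularValues) {D : ℕ} (hD : 0 < D)
    (hodd : Odd D) (hsq : Squarefree D) {K : Type} [Field K] [NumberField K] (hK : IsImaginaryQuadratic K)
    (ι : K →+* ℂ) (w : 𝓞 K) (hw : ι (w : K) = I * (Real.sqrt (2 * D) : ℝ))
    (hbasis : IsZBasis w (⊤ : Ideal (𝓞 K)) 1 0 1) :
    ∃ x' : rayClassField K ⊤, algClosureEmb ι x' = X (omegaPt D hD) := by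
  have htop : (⊤ : Ideal (𝓞 K)) ≠ ⊥ := by simp
  have hodd1 : Odd (Ideal.absNorm (⊤ : Ideal (𝓞 K))) := by simp
  exact (h D hD hodd hsq K hK ι w hw ⊤ htop hodd1 1 0 1 (by norm_num) (dvd_zero 8) hbasis).1.1

end Fact

/-! ## §4 The points `P_𝒜` on `C : 2Y² = X⁴ + 1` — Def. 2.1, 2.5, 2.7, 2.9, Lemmas 2.6/2.10 and the named
fact: Theorems 2.8 and 2.11 (pp. 48, 50–51) (appended by the same seat, g47: SUMMON (U2) «Galois action on
mock Heegner points»)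

The printed statements (verbatim, same transcription of record, images `img/p48.jpg`, `p50.jpg`, `p51.jpg`):

* **Def. 2.1** (p. 48). «`C` is the complete non-singular model of the affine curve `2Y² = X⁴ + 1` obtained by
  adding two points at infinity, one on each real component, to the curve. We make `C` into an abelian
  variety over `ℚ` with `(1, 1)` as origin.» «Note that `(x, y) → (x⁻¹, yx⁻²)` is an endomorphism of `C` of
  order `2`. So it is multiplication by `−1`, and its fixed points, `(1, 1)`, `(1, −1)`, `(−1, 1)` and
  `(−1, −1)`, are the `2`-division points on `C`. Note also that `(x, y) → (x⁻¹, −yx⁻²)`,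
  `(x, y) → (−x⁻¹, yx⁻²)` and `(x, y) → (−x, −y)` are fixed point point free biregular maps `C → C` taking
  `(1, 1)` to `(1, −1)`, `(−1, 1)` and `(−1, −1)`. So they are translations by `(1, −1)`, `(−1, 1)` and
  `(−1, −1)`. It follows that `(1, −1) − (x, y) = (1, −1) + (x⁻¹, yx⁻²) = (x, −y)`. Similarly,
  `(−1, 1) − (x, y) = (−x, y)`.»
* **Def. 2.5** (p. 50). «Suppose `D ≡ 1 (4)`. Let `𝒜` be an ideal class of `ℤ[ω]`. Choose a representative
  `I ∈ 𝒜` of odd norm and a `ℤ`-basis `{aω + b, d}` of `I` with `ad > 0` and `b ≡ 0 (8)`. Set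
  `η = (aω + b)/d`. Then `P_𝒜` is the point `((2/𝔑I)X(η), (2/𝔑I)Y(η))`.» Remark: «Since `2Y² = X⁴ + 1`,
  `P_𝒜` lies on `C`. Furthermore Theorem 2.4 shows that `P_𝒜` is independent of the choice of `I` and its
  `ℤ`-basis, and is rational over `H`.»
* **Lemma 2.6** (p. 50). «Let `P_𝒪 = (x, y)` and `P_m` be the point of `C` attached to the maximal ideal
  `m = (ω, 2)` of `ℤ[ω]`. If `D ≡ 1 (8)` then `P_m = −P_𝒪` while if `D ≡ 5 (8)`, `P_m = (−1, −1) − P_𝒪`.»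
  [proof: «`P_m = ((2/D)x⁻¹, (2/D)yx⁻²)`».]
* **Def. 2.7.** «`C_ℝ` consists of all `P ∈ C` with `P̄ = P`. The two connected components of `C_ℝ` are `C_ℝ⁺`
  consisting of all `(x, y) ∈ C_ℝ` with `y > 0` and `C_ℝ⁻` consisting of all `(x, y) ∈ C_ℝ` with `y < 0`.»
* **Thm. 2.8** (p. 50). «Suppose `D ≡ 1 (4)`. Then: (1) Each `P_𝒜` is an `H`-rational point of `C`.
  (2) `P̄_𝒜 = P_{𝒜⁻¹}`. If `J` is an ideal class the Artin automorphism `σ_J` maps `P_𝒜` to `P_{J⁻¹𝒜}`.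
  (3) `P_{m𝒜} + P_𝒜 = (1, 1)` or `(−1, −1)` according as `D ≡ 1` or `5 (8)`. (4) Let `q` be a divisor of
  `D` and `𝒜` the ideal class containing `(ω, q)`. Then `P_𝒜` lies on `C_ℝ⁺` if `q ≡ ±1 (8)` and on `C_ℝ⁻`
  if `q ≡ ±3 (8)`.»
* **Def. 2.9** (p. 51). «Suppose `D ≡ 3 (4)`. Let `𝒜` be an ideal class of `ℤ[ω]`. Choose a representative
  `I ∈ 𝒜` of odd norm and a `ℤ`-basis `{aω + b, d}` of `I` with `ad > 0` and `b ≡ 0 (8)`. Set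
  `η = (aω + b)/d`. Then `P_𝒜` is the point `((2/𝔑I) iX(η), (−2/𝔑I) Y(η))`.» Remark: «The `P_𝒜` lie on
  `C`. Theorem 2.4 shows that `P_𝒜` is independent of the choice of `I` and its `ℤ`-basis and is rational
  over `H(i)`.»
* **Lemma 2.10** (p. 51). «Let `P_𝒪 = (ix, y)` and `P_m` be the points of `C` attached to the principal
  class and the class of `m = (ω, 2)`. Then `P_m = P_𝒪 + (1, −1)` or `P_𝒪 + (−1, 1)` according as `D ≡ 3`
  or `7 (8)`.» «Now let `𝒟` consist of all `P ∈ C` with `P̄ + P = (−1, 1)`. Then `(iu, v)` is in `𝒟` if and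
  only if `(u, v)` is in `C_ℝ`. So `𝒟` has two connected components, `𝒟⁺` and `𝒟⁻`, distinguished by the
  sign of the second co-ordinate `v`.»
* **Thm. 2.11** (p. 51). «Suppose `D ≡ 3 (4)`. Then: (1) Each `P_𝒜` is an `H(i)`-rational point of `C`.
  (2) Complex conjugation and the involution of `H(i)/H` map `P_𝒜` to `(−1, 1) − P_{𝒜⁻¹}` and
  `P_𝒜 + (−1, −1)` respectively. If `σ` is an automorphism of `H(i)` trivial on `K(i)` then
  `σ(P_𝒜) = P_{J⁻¹𝒜}`, where `J` is the ideal class whose Artin automorphism is `σ|H`.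
  (3) `P_{m𝒜} − P_𝒜 = (1, −1)` or `(−1, 1)` according as `D ≡ 3` or `7 (8)`. (4) Let `q` be a divisor of
  `D` and `𝒜` the ideal class containing `(ω, q)`. Then `P_𝒜` lies on `𝒟⁺` if `q ≡ 1` or `3 (8)` and on
  `𝒟⁻` if `q ≡ 5` or `7 (8)`.» [proof: «If `P_𝒜 = (iu, v)`, … `u` and `iv` are in `H`. So the involution
  of `H(i)/H` maps `(iu, v)` to `(−iu, −v) = P_𝒜 + (−1, −1)`.»]
* p. 51: «all we shall use are the properties of the `P_𝒜` given in Theorems 2.8 and 2.11 … `G` will be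
  the ideal class-group of `K` and `𝒜 → σ_𝒜` the isomorphism of `G` with `G(H/K)` given by the Artin
  symbol.»

Transcription (word → tree object). A point of `C` enters through its affine coordinates
`(x, y) ∈ ℂ × ℂ` (every `P_𝒜` is affine: `X` has no zeros), `OnC P` is the equation `2y² = x⁴ + 1`; the
group law of `C` enters the printed statements ONLY through the four explicit maps of Def. 2.1, typed as
coordinate maps: `curveNeg` = «multiplication by `−1`» `(x,y) ↦ (x⁻¹, yx⁻²)`, `translOneNegOne` =
«translation by `(1,−1)`» `(x,y) ↦ (x⁻¹, −yx⁻²)`, `translNegOneOne` = «translation by `(−1,1)`»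
`(x,y) ↦ (−x⁻¹, yx⁻²)`, `translNegOneNegOne` = «translation by `(−1,−1)`» `(x,y) ↦ (−x, −y)`; hence
«`P_{m𝒜} + P_𝒜 = (1, 1)`» is `P_{m𝒜} = −P_𝒜 = curveNeg P_𝒜`, «`= (−1, −1)`» is
`P_{m𝒜} = (−1,−1) − P_𝒜 = (−P_𝒜) + (−1,−1)`, «`P_{m𝒜} − P_𝒜 = (1, −1)`» is `P_{m𝒜} = P_𝒜 + (1,−1)`,
and «`(−1, 1) − (x, y)`» is `(−x, y)` (the printed computations of Def. 2.1 and of the proofs of Lemmas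
2.6, 2.10). An ideal class `𝒜` is carried by an ADMISSIBLE DATUM `δ = (I, a, b, d)` — exactly the choices
of Def. 2.5/2.9 (`MockDatum w`: `I ≠ 0` of odd norm, `ℤ`-basis `{aw + b, d}`, `ad > 0`, `8 ∣ b`) — and
`P_𝒜` is `mockPtOne D δ` (`D ≡ 1 (4)`) / `mockPtThree D δ` (`D ≡ 3 (4)`); relations between classes are
written through the Artin isomorphism `𝒜 ↦ σ_𝒜` of p. 51, `σ_I = artinSymbol (galFrob K K(1)) I`:
«`I' ∈ 𝒜⁻¹`» is `σ_{I'} = σ_I⁻¹`; «`I' ∈ m𝒜`», `m = (ω, 2) = Ideal.span {w, 2}`, is `σ_{I'} = σ_m σ_I`;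
«`I' ∈ J⁻¹𝒜`» is `σ_{I'} = σ_J⁻¹ σ_I`; «`𝒜 ∋ (ω, q)`» is `σ_I = σ_{(w, q)}`. «`P̄`» is coordinatewise
`starRingEnd ℂ`; «`P ∈ C_ℝ^±`» is: both coordinates real and `±y > 0`; «`P ∈ 𝒟^±`» is: `P = (iu, v)` with
`u, v` real and `±v > 0` (the printed description of `𝒟`).
WHAT IS PROVED AND WHAT IS A FACT. Thm. 2.8 (1), the `σ_J`-sentence of 2.8 (2) and the Remark after
Def. 2.5 (independence of the choices), and likewise Thm. 2.11 (1) in the printed proof's form «`u` and `iv`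
are in `H`» (which carries the involution sentence of 2.11 (2)), its `σ`-sentence and the Remark after
Def. 2.9, FOLLOW from Thm. 2.4 exactly as in print (`P_𝒜 = σ_𝒜⁻¹ P_𝒪`) and are PROVED below from
`thm23_thm24_singularValues`; «`P_𝒜` lies on `C`» is PROVED from `thm15_XY`. The ONE new named fact
`thm28_thm211_mockHeegnerPoints` holds the remaining printed content and nothing else: 2.8 (2) first
sentence, (3), (4); 2.11 (2) first map, (3), (4) (Lemmas 2.6/2.10 are the case `𝒜 = 𝒪` of (3)). -/

section MockHeegner

open _root_.NumberField
open Literature.NumberTheory.EllipticCurves (IsImaginaryQuadratic)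
open Literature.NumberTheory.NumberFields (rayClassField)
open Literature.NumberTheory.GaloisRepresentations (galFrob)
open Literature.NumberTheory.LFunctions.AbelianDensity (artinSymbol)
open Literature.NumberTheory.ComplexMultiplication.EllipticUnits (algClosureEmb)

/-! ### Def. 2.1 in coordinates -/

/-- The affine equation of **`C : 2Y² = X⁴ + 1`** on a coordinate pair `P = (x, y)`.
[cite: Monsky1990MockHeegner, Def. 2.1 (p. 48)] -/
def OnC (P : ℂ × ℂ) : Prop := 2 * P.2 ^ 2 = P.1 ^ 4 + 1

/-- Unfolding `OnC`. [cite: Monsky1990MockHeegner, Def. 2.1 (p. 48)] -/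
theorem onC_iff (P : ℂ × ℂ) : OnC P ↔ 2 * P.2 ^ 2 = P.1 ^ 4 + 1 := Iff.rfl

/-- «`(x, y) → (x⁻¹, yx⁻²)` is an endomorphism of `C` of order `2`. So it is multiplication by `−1`»
(origin `(1, 1)`), as a coordinate map. [cite: Monsky1990MockHeegner, Def. 2.1 (p. 48)] -/
def curveNeg (P : ℂ × ℂ) : ℂ × ℂ := (P.1⁻¹, P.2 * P.1⁻¹ ^ 2)

/-- «`(x, y) → (x⁻¹, −yx⁻²)` … translation by `(1, −1)`», as a coordinate map.
[cite: Monsky1990MockHeegner, Def. 2.1 (p. 48)] -/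
def translOneNegOne (P : ℂ × ℂ) : ℂ × ℂ := (P.1⁻¹, -(P.2 * P.1⁻¹ ^ 2))

/-- «`(x, y) → (−x⁻¹, yx⁻²)` … translation by `(−1, 1)`», as a coordinate map.
[cite: Monsky1990MockHeegner, Def. 2.1 (p. 48)] -/
def translNegOneOne (P : ℂ × ℂ) : ℂ × ℂ := (-P.1⁻¹, P.2 * P.1⁻¹ ^ 2)

/-- «`(x, y) → (−x, −y)` … translation by `(−1, −1)`», as a coordinate map.
[cite: Monsky1990MockHeegner, Def. 2.1 (p. 48)] -/
def translNegOneNegOne (P : ℂ × ℂ) : ℂ × ℂ := (-P.1, -P.2)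

/-- «It follows that `(1, −1) − (x, y) = (1, −1) + (x⁻¹, yx⁻²) = (x, −y)`» — PROVED for the coordinate
maps (`x ≠ 0`). [cite: Monsky1990MockHeegner, Def. 2.1 (p. 48)] -/
theorem translOneNegOne_curveNeg (P : ℂ × ℂ) (hx : P.1 ≠ 0) :
    translOneNegOne (curveNeg P) = (P.1, -P.2) := by
  obtain ⟨x, y⟩ := P
  simp only [translOneNegOne, curveNeg, inv_inv, Prod.mk.injEq] at hx ⊢
  exact ⟨trivial, by field_simp⟩

/-- «Similarly, `(−1, 1) − (x, y) = (−x, y)`» (`= (−1, 1) + (x⁻¹, yx⁻²)`) — PROVED for the coordinate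
maps (`x ≠ 0`). [cite: Monsky1990MockHeegner, Def. 2.1 (p. 48)] -/
theorem translNegOneOne_curveNeg (P : ℂ × ℂ) (hx : P.1 ≠ 0) :
    translNegOneOne (curveNeg P) = (-P.1, P.2) := by
  obtain ⟨x, y⟩ := P
  simp only [translNegOneOne, curveNeg, inv_inv, Prod.mk.injEq] at hx ⊢
  exact ⟨trivial, by field_simp⟩

/-- `(−1, −1) − (x, y) = (−1, −1) + (x⁻¹, yx⁻²) = (−x⁻¹, −yx⁻²)` (the computation in the proof of
Lemma 2.6: «`P_m = ((2/D)x⁻¹, (2/D)yx⁻²)`», `(2/D) = −1` when `D ≡ 5 (8)`), by `rfl`.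
[cite: Monsky1990MockHeegner, Def. 2.1 (p. 48), Lemma 2.6 (p. 50)] -/
theorem translNegOneNegOne_curveNeg (P : ℂ × ℂ) :
    translNegOneNegOne (curveNeg P) = (-P.1⁻¹, -(P.2 * P.1⁻¹ ^ 2)) := rfl

/-- Multiplication by `−1` preserves the equation of `C` (`x ≠ 0`). PROVED.
[cite: Monsky1990MockHeegner, Def. 2.1 (p. 48)] -/
theorem OnC.curveNeg {P : ℂ × ℂ} (h : OnC P) (hx : P.1 ≠ 0) : OnC (curveNeg P) := by
  obtain ⟨x, y⟩ := P
  simp only [OnC, Monsky1990.curveNeg] at h hx ⊢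
  field_simp
  linear_combination h

/-- The three translations preserve the equation of `C` (`x ≠ 0` for the first two). PROVED.
[cite: Monsky1990MockHeegner, Def. 2.1 (p. 48)] -/
theorem OnC.transl {P : ℂ × ℂ} (h : OnC P) (hx : P.1 ≠ 0) :
    OnC (translOneNegOne P) ∧ OnC (translNegOneOne P) ∧ OnC (translNegOneNegOne P) := by
  obtain ⟨x, y⟩ := P
  simp only [OnC, translOneNegOne, translNegOneOne, translNegOneNegOne] at h hx ⊢
  refine ⟨?_, ?_, ?_⟩
  · field_simp
    linear_combination h
  · field_simp
    linear_combination h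
  · linear_combination h

/-! ### Def. 2.5 / 2.9: admissible data and the points `P_𝒜` -/

variable {K : Type} [Field K] [NumberField K]

/-- **Admissible datum** for an ideal class of `ℤ[ω] = 𝓞_K` — the choices of Def. 2.5/2.9 (and Thm. 2.4):
«a representative `I ∈ 𝒜` of odd norm and a `ℤ`-basis `{aω + b, d}` of `I` with `ad > 0` and
`b ≡ 0 (8)`» (`I ≠ 0`). The class `𝒜` it represents is read through `σ_I = artinSymbol (galFrob K K(1)) I`.
[cite: Monsky1990MockHeegner, Def. 2.5 (p. 50), Def. 2.9 (p. 51)] -/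
structure MockDatum (w : 𝓞 K) where
  /-- the representative `I ∈ 𝒜` -/
  ideal : Ideal (𝓞 K)
  /-- the `ℤ`-basis `{aω + b, d}` of `I` -/
  a : ℤ
  b : ℤ
  d : ℤ
  ne_bot : ideal ≠ ⊥
  odd_norm : Odd (Ideal.absNorm ideal)
  pos : 0 < a * d
  eight_dvd : (8 : ℤ) ∣ b
  basis : IsZBasis w ideal a b d

/-- **`P_𝒜 = ((2/𝔑I)·X(η), (2/𝔑I)·Y(η))`**, `η = (aω + b)/d` (the case `D ≡ 1 (4)`).
[cite: Monsky1990MockHeegner, Def. 2.5 (p. 50)] -/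
def mockPtOne (D : ℕ) (hD : 0 < D) {w : 𝓞 K} (δ : MockDatum w) : ℂ × ℂ :=
  ((J(2 | Ideal.absNorm δ.ideal) : ℂ) * X (etaPt D hD δ.a δ.b δ.d δ.pos),
   (J(2 | Ideal.absNorm δ.ideal) : ℂ) * Y (etaPt D hD δ.a δ.b δ.d δ.pos))

/-- **`P_𝒜 = ((2/𝔑I)·iX(η), (−2/𝔑I)·Y(η))`**, `η = (aω + b)/d` (the case `D ≡ 3 (4)`).
[cite: Monsky1990MockHeegner, Def. 2.9 (p. 51)] -/
def mockPtThree (D : ℕ) (hD : 0 < D) {w : 𝓞 K} (δ : MockDatum w) : ℂ × ℂ :=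
  ((J(2 | Ideal.absNorm δ.ideal) : ℂ) * (I * X (etaPt D hD δ.a δ.b δ.d δ.pos)),
   (J(-2 | Ideal.absNorm δ.ideal) : ℂ) * Y (etaPt D hD δ.a δ.b δ.d δ.pos))

/-- The Jacobi symbols `(±2/𝔑I)` of an admissible datum are `±1` (`𝔑I` odd), so square to `1` in `ℂ`.
[cite: Monsky1990MockHeegner, Def. 2.5 (p. 50)] -/
theorem MockDatum.jacobiSym_sq {w : 𝓞 K} (δ : MockDatum w) {s : ℤ} (hs : s = 2 ∨ s = -2) :
    ((J(s | Ideal.absNorm δ.ideal) : ℤ) : ℂ) ^ 2 = 1 := by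
  have hg : s.gcd (Ideal.absNorm δ.ideal) = 1 := by
    have h2 : Nat.Coprime 2 (Ideal.absNorm δ.ideal) := Nat.coprime_two_left.mpr δ.odd_norm
    rcases hs with rfl | rfl
    · exact h2
    · exact h2
  rcases jacobiSym.eq_one_or_neg_one hg with h | h <;> simp [h]

/-- **Remark after Def. 2.5: «Since `2Y² = X⁴ + 1`, `P_𝒜` lies on `C`»** — PROVED from Thm. 1.5 (3)
(`(2/𝔑I)² = 1`). [cite: Monsky1990MockHeegner, Def. 2.5 Remark (p. 50), Thm. 1.5 (3) (p. 47)] -/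
theorem thm15_XY.onC_mockPtOne (h : thm15_XY) (D : ℕ) (hD : 0 < D) {w : 𝓞 K} (δ : MockDatum w) :
    OnC (mockPtOne D hD δ) := by
  obtain ⟨-, -, h3, -⟩ := h
  have hc := h3 (etaPt D hD δ.a δ.b δ.d δ.pos)
  have hJ := δ.jacobiSym_sq (s := 2) (Or.inl rfl)
  simp only [OnC, mockPtOne]
  linear_combination ((J(2 | Ideal.absNorm δ.ideal) : ℂ) ^ 2) * hc +
    (1 - (J(2 | Ideal.absNorm δ.ideal) : ℂ) ^ 2 * X (etaPt D hD δ.a δ.b δ.d δ.pos) ^ 4) * hJ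

/-- **Remark after Def. 2.9: «The `P_𝒜` lie on `C`»** — PROVED from Thm. 1.5 (3) (`i⁴ = 1`,
`(±2/𝔑I)² = 1`). [cite: Monsky1990MockHeegner, Def. 2.9 Remark (p. 51), Thm. 1.5 (3) (p. 47)] -/
theorem thm15_XY.onC_mockPtThree (h : thm15_XY) (D : ℕ) (hD : 0 < D) {w : 𝓞 K} (δ : MockDatum w) :
    OnC (mockPtThree D hD δ) := by
  obtain ⟨-, -, h3, -⟩ := h
  have hc := h3 (etaPt D hD δ.a δ.b δ.d δ.pos)
  have hJ := δ.jacobiSym_sq (s := 2) (Or.inl rfl)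
  have hJ' := δ.jacobiSym_sq (s := -2) (Or.inr rfl)
  have hI4 : (I : ℂ) ^ 4 = 1 := by
    rw [show (4 : ℕ) = 2 * 2 from rfl, pow_mul, Complex.I_sq]; norm_num
  simp only [OnC, mockPtThree]
  linear_combination hc +
    (-(X (etaPt D hD δ.a δ.b δ.d δ.pos) ^ 4) * I ^ 4 * ((J(2 | Ideal.absNorm δ.ideal) : ℂ) ^ 2 + 1)) * hJ +
    (2 * Y (etaPt D hD δ.a δ.b δ.d δ.pos) ^ 2) * hJ' +
    (-(X (etaPt D hD δ.a δ.b δ.d δ.pos) ^ 4)) * hI4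

/-! ### The named fact: Theorems 2.8 and 2.11 -/

/-- **Monsky 1990, Thm. 2.8 (p. 50, `D ≡ 1 (4)`) and Thm. 2.11 (p. 51, `D ≡ 3 (4)`) — complex conjugation,
the `m`-translation law and the real loci of the points `P_𝒜`** (the parts NOT already consequences of
Thm. 2.4; see the section docstring). Printed: 2.8 «(2) `P̄_𝒜 = P_{𝒜⁻¹}`. … (3) `P_{m𝒜} + P_𝒜 = (1, 1)` or
`(−1, −1)` according as `D ≡ 1` or `5 (8)`. (4) Let `q` be a divisor of `D` and `𝒜` the ideal class
containing `(ω, q)`. Then `P_𝒜` lies on `C_ℝ⁺` if `q ≡ ±1 (8)` and on `C_ℝ⁻` if `q ≡ ±3 (8)`.»;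
2.11 «(2) Complex conjugation … map[s] `P_𝒜` to `(−1, 1) − P_{𝒜⁻¹}` …. (3) `P_{m𝒜} − P_𝒜 = (1, −1)` or
`(−1, 1)` according as `D ≡ 3` or `7 (8)`. (4) Let `q` be a divisor of `D` and `𝒜` the ideal class
containing `(ω, q)`. Then `P_𝒜` lies on `𝒟⁺` if `q ≡ 1` or `3 (8)` and on `𝒟⁻` if `q ≡ 5` or `7 (8)`.»
Typed (header as in `thm23_thm24_singularValues`: `D > 0` odd square-free, `K` imaginary quadratic,
`ι : K → ℂ`, `w ∈ 𝓞_K` with `ι w = i√(2D)`; `σ_I = artinSymbol (galFrob K K(1)) I`; classes through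
admissible data `δ`, see `MockDatum`): for `D ≡ 1 (4)` and `P = mockPtOne D`: (2) if `σ_{I'} = σ_I⁻¹` then
`P_{δ'} = P̄_δ`; (3) if `σ_{I'} = σ_{(w,2)}·σ_I` then `P_{δ'} = −P_δ` (`D ≡ 1 (8)`), resp.
`P_{δ'} = (−P_δ) + (−1,−1)` (`D ≡ 5 (8)`), in the coordinates of Def. 2.1; (4) if `q ∣ D` and
`σ_I = σ_{(w,q)}` then `P_δ = (u, v)` with `u, v ∈ ℝ`, `v > 0` if `q ≡ ±1 (8)`, `v < 0` if `q ≡ ±3 (8)`.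
For `D ≡ 3 (4)` and `P = mockPtThree D`: (2) if `σ_{I'} = σ_I⁻¹` then `P̄_δ = (−x', y')` where
`P_{δ'} = (x', y')`; (3) if `σ_{I'} = σ_{(w,2)}·σ_I` then `P_{δ'} = P_δ + (1,−1)` (`D ≡ 3 (8)`), resp.
`P_δ + (−1,1)` (`D ≡ 7 (8)`); (4) if `q ∣ D` and `σ_I = σ_{(w,q)}` then `P_δ = (iu, v)` with `u, v ∈ ℝ`,
`v > 0` if `q ≡ 1, 3 (8)`, `v < 0` if `q ≡ 5, 7 (8)`. Named fact; nothing asserted (proofs pp. 50–51: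
`{aω − b, d}` is a `ℤ`-basis of `Ī`, `X(−η̄) = conj X(η)`; Lemmas 2.6/2.10 via `ω/D = −2/ω̄…` and Thm. 1.5;
«`Y` takes positive values on `iℝ⁺`»).
[cite: Monsky1990MockHeegner, Thm. 2.8 (2)–(4) (p. 50), Thm. 2.11 (2)–(4) (p. 51), Lemma 2.6 (p. 50), Lemma 2.10 (p. 51), Def. 2.7 (p. 50)] -/
def thm28_thm211_mockHeegnerPoints : Prop :=
  ∀ (D : ℕ) (hD : 0 < D), Odd D → Squarefree D →
  ∀ (K : Type) [Field K] [NumberField K], IsImaginaryQuadratic K → ∀ (ι : K →+* ℂ) (w : 𝓞 K),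
    ι (w : K) = I * (Real.sqrt (2 * D) : ℝ) →
    -- Thm. 2.8: `D ≡ 1 (mod 4)`, `P_𝒜 = mockPtOne D δ`
    (D % 4 = 1 →
      -- (2) «P̄_𝒜 = P_{𝒜⁻¹}»
      (∀ δ δ' : MockDatum w,
        artinSymbol (galFrob K (rayClassField K ⊤)) δ'.ideal =
          (artinSymbol (galFrob K (rayClassField K ⊤)) δ.ideal)⁻¹ →
        mockPtOne D hD δ' =
          (starRingEnd ℂ (mockPtOne D hD δ).1, starRingEnd ℂ (mockPtOne D hD δ).2)) ∧
      -- (3) «P_{m𝒜} + P_𝒜 = (1, 1) or (−1, −1) according as D ≡ 1 or 5 (8)», `m = (ω, 2)`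
      (∀ δ δ' : MockDatum w,
        artinSymbol (galFrob K (rayClassField K ⊤)) δ'.ideal =
          artinSymbol (galFrob K (rayClassField K ⊤)) (Ideal.span {w, 2}) *
            artinSymbol (galFrob K (rayClassField K ⊤)) δ.ideal →
        (D % 8 = 1 → mockPtOne D hD δ' = curveNeg (mockPtOne D hD δ)) ∧
        (D % 8 = 5 → mockPtOne D hD δ' = translNegOneNegOne (curveNeg (mockPtOne D hD δ)))) ∧
      -- (4) «q ∣ D, 𝒜 ∋ (ω, q): P_𝒜 ∈ C_ℝ⁺ if q ≡ ±1 (8), C_ℝ⁻ if q ≡ ±3 (8)»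
      (∀ q : ℕ, q ∣ D → ∀ δ : MockDatum w,
        artinSymbol (galFrob K (rayClassField K ⊤)) δ.ideal =
          artinSymbol (galFrob K (rayClassField K ⊤)) (Ideal.span {w, (q : 𝓞 K)}) →
        ∃ u v : ℝ, mockPtOne D hD δ = ((u : ℂ), (v : ℂ)) ∧
          ((q % 8 = 1 ∨ q % 8 = 7) → 0 < v) ∧ ((q % 8 = 3 ∨ q % 8 = 5) → v < 0))) ∧
    -- Thm. 2.11: `D ≡ 3 (mod 4)`, `P_𝒜 = mockPtThree D δ`
    (D % 4 = 3 →
      -- (2) «complex conjugation maps P_𝒜 to (−1, 1) − P_{𝒜⁻¹}» (`(−1,1) − (x,y) = (−x, y)`, Def. 2.1)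
      (∀ δ δ' : MockDatum w,
        artinSymbol (galFrob K (rayClassField K ⊤)) δ'.ideal =
          (artinSymbol (galFrob K (rayClassField K ⊤)) δ.ideal)⁻¹ →
        (starRingEnd ℂ (mockPtThree D hD δ).1, starRingEnd ℂ (mockPtThree D hD δ).2) =
          (-(mockPtThree D hD δ').1, (mockPtThree D hD δ').2)) ∧
      -- (3) «P_{m𝒜} − P_𝒜 = (1, −1) or (−1, 1) according as D ≡ 3 or 7 (8)»
      (∀ δ δ' : MockDatum w,
        artinSymbol (galFrob K (rayClassField K ⊤)) δ'.ideal =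
          artinSymbol (galFrob K (rayClassField K ⊤)) (Ideal.span {w, 2}) *
            artinSymbol (galFrob K (rayClassField K ⊤)) δ.ideal →
        (D % 8 = 3 → mockPtThree D hD δ' = translOneNegOne (mockPtThree D hD δ)) ∧
        (D % 8 = 7 → mockPtThree D hD δ' = translNegOneOne (mockPtThree D hD δ))) ∧
      -- (4) «q ∣ D, 𝒜 ∋ (ω, q): P_𝒜 ∈ 𝒟⁺ if q ≡ 1, 3 (8), 𝒟⁻ if q ≡ 5, 7 (8)», `P_𝒜 = (iu, v)`
      (∀ q : ℕ, q ∣ D → ∀ δ : MockDatum w,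
        artinSymbol (galFrob K (rayClassField K ⊤)) δ.ideal =
          artinSymbol (galFrob K (rayClassField K ⊤)) (Ideal.span {w, (q : 𝓞 K)}) →
        ∃ u v : ℝ, mockPtThree D hD δ = (I * (u : ℂ), (v : ℂ)) ∧
          ((q % 8 = 1 ∨ q % 8 = 3) → 0 < v) ∧ ((q % 8 = 5 ∨ q % 8 = 7) → v < 0)))

/-! ### What follows from Thm. 2.4 (`thm23_thm24_singularValues`): 2.8 (1), 2.8 (2) second sentence,
2.11 (1)–(2) (`u, iv ∈ H`, `σ`-sentence), and the Remarks after Def. 2.5/2.9 — PROVED -/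

/-- `P_𝒜 = σ_𝒜⁻¹ P_𝒪` coordinatewise, case `D ≡ 1 (4)` — the content of Thm. 2.4 read on Def. 2.5: for
`x', y' ∈ K(1)` with `ι̂ x' = X(ω)`, `ι̂ y' = Y(ω)`, `P_δ = (ι̂ (σ_I⁻¹ x'), ι̂ (σ_I⁻¹ y'))`. PROVED from
`thm23_thm24_singularValues`. [cite: Monsky1990MockHeegner, Thm. 2.4 (p. 49), Def. 2.5 (p. 50)] -/
theorem thm23_thm24_singularValues.mockPtOne_eq (h : thm23_thm24_singularValues) {D : ℕ} (hD : 0 < D)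
    (hodd : Odd D) (hsq : Squarefree D) (h1 : D % 4 = 1) (hK : IsImaginaryQuadratic K) (ι : K →+* ℂ)
    (w : 𝓞 K) (hw : ι (w : K) = I * (Real.sqrt (2 * D) : ℝ)) (δ : MockDatum w)
    {x' y' : rayClassField K ⊤} (hx : algClosureEmb ι x' = X (omegaPt D hD))
    (hy : algClosureEmb ι y' = Y (omegaPt D hD)) :
    mockPtOne D hD δ =
      (algClosureEmb ι ((artinSymbol (galFrob K (rayClassField K ⊤)) δ.ideal)⁻¹ x'),
       algClosureEmb ι ((artinSymbol (galFrob K (rayClassField K ⊤)) δ.ideal)⁻¹ y')) := by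
  obtain ⟨⟨-, hX⟩, h14, -⟩ :=
    h D hD hodd hsq K hK ι w hw δ.ideal δ.ne_bot δ.odd_norm δ.a δ.b δ.d δ.pos δ.eight_dvd δ.basis
  obtain ⟨-, hY⟩ := h14 h1
  exact Prod.ext (hX x' hx).symm (hY y' hy).symm

/-- **Thm. 2.8 (1): «Each `P_𝒜` is an `H`-rational point of `C`»** (`D ≡ 1 (4)`; rationality — «lies on
`C`» is `thm15_XY.onC_mockPtOne`). PROVED from Thm. 2.4.
[cite: Monsky1990MockHeegner, Thm. 2.8 (1) (p. 50), Thm. 2.4 (p. 49)] -/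
theorem thm23_thm24_singularValues.mockPtOne_rational (h : thm23_thm24_singularValues) {D : ℕ}
    (hD : 0 < D) (hodd : Odd D) (hsq : Squarefree D) (h1 : D % 4 = 1) (hK : IsImaginaryQuadratic K)
    (ι : K →+* ℂ) (w : 𝓞 K) (hw : ι (w : K) = I * (Real.sqrt (2 * D) : ℝ)) (δ : MockDatum w) :
    ∃ x'' y'' : rayClassField K ⊤,
      algClosureEmb ι x'' = (mockPtOne D hD δ).1 ∧ algClosureEmb ι y'' = (mockPtOne D hD δ).2 := by
  obtain ⟨⟨⟨x', hx'⟩, -⟩, h14, -⟩ :=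
    h D hD hodd hsq K hK ι w hw δ.ideal δ.ne_bot δ.odd_norm δ.a δ.b δ.d δ.pos δ.eight_dvd δ.basis
  obtain ⟨⟨y', hy'⟩, -⟩ := h14 h1
  rw [h.mockPtOne_eq hD hodd hsq h1 hK ι w hw δ hx' hy']
  exact ⟨_, _, rfl, rfl⟩

/-- **Remark after Def. 2.5: «`P_𝒜` is independent of the choice of `I` and its `ℤ`-basis»** — two
admissible data with the same Artin symbol (= the same class, p. 51) give the same point (`D ≡ 1 (4)`).
PROVED from Thm. 2.4. [cite: Monsky1990MockHeegner, Def. 2.5 Remark (p. 50), Thm. 2.4 (p. 49)] -/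
theorem thm23_thm24_singularValues.mockPtOne_wellDefined (h : thm23_thm24_singularValues) {D : ℕ}
    (hD : 0 < D) (hodd : Odd D) (hsq : Squarefree D) (h1 : D % 4 = 1) (hK : IsImaginaryQuadratic K)
    (ι : K →+* ℂ) (w : 𝓞 K) (hw : ι (w : K) = I * (Real.sqrt (2 * D) : ℝ)) (δ δ' : MockDatum w)
    (hσ : artinSymbol (galFrob K (rayClassField K ⊤)) δ'.ideal =
      artinSymbol (galFrob K (rayClassField K ⊤)) δ.ideal) :
    mockPtOne D hD δ' = mockPtOne D hD δ := by
  obtain ⟨⟨⟨x', hx'⟩, -⟩, h14, -⟩ :=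
    h D hD hodd hsq K hK ι w hw δ.ideal δ.ne_bot δ.odd_norm δ.a δ.b δ.d δ.pos δ.eight_dvd δ.basis
  obtain ⟨⟨y', hy'⟩, -⟩ := h14 h1
  rw [h.mockPtOne_eq hD hodd hsq h1 hK ι w hw δ hx' hy', h.mockPtOne_eq hD hodd hsq h1 hK ι w hw δ' hx' hy',
    hσ]

/-- **Thm. 2.8 (2), second sentence: «If `J` is an ideal class the Artin automorphism `σ_J` maps `P_𝒜` to
`P_{J⁻¹𝒜}`»** (`D ≡ 1 (4)`): for `H`-rational coordinates `x'', y''` of `P_δ` and any admissible `δ'` with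
`σ_{I'} = σ_J⁻¹ σ_I`, `(ι̂ (σ_J x''), ι̂ (σ_J y'')) = P_{δ'}`. PROVED from Thm. 2.4 (`σ_J σ_𝒜⁻¹ =
(σ_J⁻¹σ_𝒜)⁻¹`, `G(H/K)` abelian). [cite: Monsky1990MockHeegner, Thm. 2.8 (2) (p. 50), Thm. 2.4 (p. 49)] -/
theorem thm23_thm24_singularValues.mockPtOne_galois (h : thm23_thm24_singularValues) {D : ℕ}
    (hD : 0 < D) (hodd : Odd D) (hsq : Squarefree D) (h1 : D % 4 = 1) (hK : IsImaginaryQuadratic K)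
    (ι : K →+* ℂ) (w : 𝓞 K) (hw : ι (w : K) = I * (Real.sqrt (2 * D) : ℝ)) (J : Ideal (𝓞 K))
    (δ δ' : MockDatum w)
    (hσ : artinSymbol (galFrob K (rayClassField K ⊤)) δ'.ideal =
      (artinSymbol (galFrob K (rayClassField K ⊤)) J)⁻¹ *
        artinSymbol (galFrob K (rayClassField K ⊤)) δ.ideal)
    {x'' y'' : rayClassField K ⊤} (hx : algClosureEmb ι x'' = (mockPtOne D hD δ).1)
    (hy : algClosureEmb ι y'' = (mockPtOne D hD δ).2) :
    (algClosureEmb ι (artinSymbol (galFrob K (rayClassField K ⊤)) J x''),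
      algClosureEmb ι (artinSymbol (galFrob K (rayClassField K ⊤)) J y'')) = mockPtOne D hD δ' := by
  have hinj : Function.Injective (algClosureEmb ι) := (algClosureEmb ι).injective
  obtain ⟨⟨⟨x', hx'⟩, -⟩, h14, -⟩ :=
    h D hD hodd hsq K hK ι w hw δ.ideal δ.ne_bot δ.odd_norm δ.a δ.b δ.d δ.pos δ.eight_dvd δ.basis
  obtain ⟨⟨y', hy'⟩, -⟩ := h14 h1
  have e := h.mockPtOne_eq hD hodd hsq h1 hK ι w hw δ hx' hy'
  have e' := h.mockPtOne_eq hD hodd hsq h1 hK ι w hw δ' hx' hy'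
  rw [e] at hx hy
  have ex : x'' = (artinSymbol (galFrob K (rayClassField K ⊤)) δ.ideal)⁻¹ x' := Subtype.ext (hinj hx)
  have ey : y'' = (artinSymbol (galFrob K (rayClassField K ⊤)) δ.ideal)⁻¹ y' := Subtype.ext (hinj hy)
  have key : (artinSymbol (galFrob K (rayClassField K ⊤)) δ'.ideal)⁻¹ =
      artinSymbol (galFrob K (rayClassField K ⊤)) J *
        (artinSymbol (galFrob K (rayClassField K ⊤)) δ.ideal)⁻¹ := by
    rw [hσ, mul_inv_rev, inv_inv, mul_comm]
  rw [e', key, ex, ey, AlgEquiv.mul_apply, AlgEquiv.mul_apply]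

/-- `P_𝒜 = σ_𝒜⁻¹ P_𝒪` coordinatewise, case `D ≡ 3 (4)` (Thm. 2.4 read on Def. 2.9): for `x', y' ∈ K(1)`
with `ι̂ x' = X(ω)`, `ι̂ y' = iY(ω)`, `P_δ = (i·ι̂ (σ_I⁻¹ x'), −i·ι̂ (σ_I⁻¹ y'))`. PROVED from
`thm23_thm24_singularValues`. [cite: Monsky1990MockHeegner, Thm. 2.4 (p. 49), Def. 2.9 (p. 51)] -/
theorem thm23_thm24_singularValues.mockPtThree_eq (h : thm23_thm24_singularValues) {D : ℕ} (hD : 0 < D)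
    (hodd : Odd D) (hsq : Squarefree D) (h3 : D % 4 = 3) (hK : IsImaginaryQuadratic K) (ι : K →+* ℂ)
    (w : 𝓞 K) (hw : ι (w : K) = I * (Real.sqrt (2 * D) : ℝ)) (δ : MockDatum w)
    {x' y' : rayClassField K ⊤} (hx : algClosureEmb ι x' = X (omegaPt D hD))
    (hy : algClosureEmb ι y' = I * Y (omegaPt D hD)) :
    mockPtThree D hD δ =
      (I * algClosureEmb ι ((artinSymbol (galFrob K (rayClassField K ⊤)) δ.ideal)⁻¹ x'),
       -I * algClosureEmb ι ((artinSymbol (galFrob K (rayClassField K ⊤)) δ.ideal)⁻¹ y')) := by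
  obtain ⟨⟨-, hX⟩, -, h34⟩ :=
    h D hD hodd hsq K hK ι w hw δ.ideal δ.ne_bot δ.odd_norm δ.a δ.b δ.d δ.pos δ.eight_dvd δ.basis
  obtain ⟨-, hY⟩ := h34 h3
  refine Prod.ext ?_ ?_
  · rw [hX x' hx]; simp only [mockPtThree]; ring
  · rw [hY y' hy]; simp only [mockPtThree]
    linear_combination ((J(-2 | Ideal.absNorm δ.ideal) : ℂ) * Y (etaPt D hD δ.a δ.b δ.d δ.pos)) *
      Complex.I_sq

/-- **Thm. 2.11 (1)–(2): «Each `P_𝒜` is an `H(i)`-rational point of `C`» in the printed proof's form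
«if `P_𝒜 = (iu, v)` … `u` and `iv` are in `H`»** (so the involution of `H(i)/H` sends `P_𝒜` to
`(−iu, −v) = P_𝒜 + (−1,−1)`), `D ≡ 3 (4)`: there are `u', v'' ∈ K(1)` with `P_δ = (i·ι̂ u', v)`,
`ι̂ v'' = i·v`. PROVED from Thm. 2.4. [cite: Monsky1990MockHeegner, Thm. 2.11 (1), (2) (p. 51), Thm. 2.4 (p. 49)] -/
theorem thm23_thm24_singularValues.mockPtThree_rational (h : thm23_thm24_singularValues) {D : ℕ}
    (hD : 0 < D) (hodd : Odd D) (hsq : Squarefree D) (h3 : D % 4 = 3) (hK : IsImaginaryQuadratic K)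
    (ι : K →+* ℂ) (w : 𝓞 K) (hw : ι (w : K) = I * (Real.sqrt (2 * D) : ℝ)) (δ : MockDatum w) :
    ∃ u' v'' : rayClassField K ⊤,
      (mockPtThree D hD δ).1 = I * algClosureEmb ι u' ∧
        algClosureEmb ι v'' = I * (mockPtThree D hD δ).2 := by
  obtain ⟨⟨⟨x', hx'⟩, -⟩, -, h34⟩ :=
    h D hD hodd hsq K hK ι w hw δ.ideal δ.ne_bot δ.odd_norm δ.a δ.b δ.d δ.pos δ.eight_dvd δ.basis
  obtain ⟨⟨y', hy'⟩, -⟩ := h34 h3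
  rw [h.mockPtThree_eq hD hodd hsq h3 hK ι w hw δ hx' hy']
  refine ⟨_, (artinSymbol (galFrob K (rayClassField K ⊤)) δ.ideal)⁻¹ y', rfl, ?_⟩
  linear_combination (algClosureEmb ι ((artinSymbol (galFrob K (rayClassField K ⊤)) δ.ideal)⁻¹ y')) *
    Complex.I_sq

/-- **Remark after Def. 2.9: «`P_𝒜` is independent of the choice of `I` and its `ℤ`-basis»** (`D ≡ 3 (4)`;
same Artin symbol ⇒ same point). PROVED from Thm. 2.4.
[cite: Monsky1990MockHeegner, Def. 2.9 Remark (p. 51), Thm. 2.4 (p. 49)] -/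
theorem thm23_thm24_singularValues.mockPtThree_wellDefined (h : thm23_thm24_singularValues) {D : ℕ}
    (hD : 0 < D) (hodd : Odd D) (hsq : Squarefree D) (h3 : D % 4 = 3) (hK : IsImaginaryQuadratic K)
    (ι : K →+* ℂ) (w : 𝓞 K) (hw : ι (w : K) = I * (Real.sqrt (2 * D) : ℝ)) (δ δ' : MockDatum w)
    (hσ : artinSymbol (galFrob K (rayClassField K ⊤)) δ'.ideal =
      artinSymbol (galFrob K (rayClassField K ⊤)) δ.ideal) :
    mockPtThree D hD δ' = mockPtThree D hD δ := by
  obtain ⟨⟨⟨x', hx'⟩, -⟩, -, h34⟩ :=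
    h D hD hodd hsq K hK ι w hw δ.ideal δ.ne_bot δ.odd_norm δ.a δ.b δ.d δ.pos δ.eight_dvd δ.basis
  obtain ⟨⟨y', hy'⟩, -⟩ := h34 h3
  rw [h.mockPtThree_eq hD hodd hsq h3 hK ι w hw δ hx' hy',
    h.mockPtThree_eq hD hodd hsq h3 hK ι w hw δ' hx' hy', hσ]

/-- **Thm. 2.11 (2), last sentence: «If `σ` is an automorphism of `H(i)` trivial on `K(i)` then
`σ(P_𝒜) = P_{J⁻¹𝒜}`, where `J` is the ideal class whose Artin automorphism is `σ|H`»** (`D ≡ 3 (4)`), in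
coordinates `P_δ = (iu, v)` with `u = ι̂ u'`, `iv = ι̂ v''`, `u', v'' ∈ H` (`σ` fixes `i`): for any admissible
`δ'` with `σ_{I'} = σ_J⁻¹ σ_I`, `P_{δ'} = (i·ι̂ (σ_J u'), −i·ι̂ (σ_J v''))`. PROVED from Thm. 2.4.
[cite: Monsky1990MockHeegner, Thm. 2.11 (2) (p. 51), Thm. 2.4 (p. 49)] -/
theorem thm23_thm24_singularValues.mockPtThree_galois (h : thm23_thm24_singularValues) {D : ℕ}
    (hD : 0 < D) (hodd : Odd D) (hsq : Squarefree D) (h3 : D % 4 = 3) (hK : IsImaginaryQuadratic K)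
    (ι : K →+* ℂ) (w : 𝓞 K) (hw : ι (w : K) = I * (Real.sqrt (2 * D) : ℝ)) (J : Ideal (𝓞 K))
    (δ δ' : MockDatum w)
    (hσ : artinSymbol (galFrob K (rayClassField K ⊤)) δ'.ideal =
      (artinSymbol (galFrob K (rayClassField K ⊤)) J)⁻¹ *
        artinSymbol (galFrob K (rayClassField K ⊤)) δ.ideal)
    {u' v'' : rayClassField K ⊤} (hu : (mockPtThree D hD δ).1 = I * algClosureEmb ι u')
    (hv : algClosureEmb ι v'' = I * (mockPtThree D hD δ).2) :
    mockPtThree D hD δ' =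
      (I * algClosureEmb ι (artinSymbol (galFrob K (rayClassField K ⊤)) J u'),
       -I * algClosureEmb ι (artinSymbol (galFrob K (rayClassField K ⊤)) J v'')) := by
  have hinj : Function.Injective (algClosureEmb ι) := (algClosureEmb ι).injective
  obtain ⟨⟨⟨x', hx'⟩, -⟩, -, h34⟩ :=
    h D hD hodd hsq K hK ι w hw δ.ideal δ.ne_bot δ.odd_norm δ.a δ.b δ.d δ.pos δ.eight_dvd δ.basis
  obtain ⟨⟨y', hy'⟩, -⟩ := h34 h3
  have e := h.mockPtThree_eq hD hodd hsq h3 hK ι w hw δ hx' hy'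
  have e' := h.mockPtThree_eq hD hodd hsq h3 hK ι w hw δ' hx' hy'
  rw [e] at hu hv
  simp only at hu hv
  have eu : u' = (artinSymbol (galFrob K (rayClassField K ⊤)) δ.ideal)⁻¹ x' :=
    Subtype.ext (hinj (mul_left_cancel₀ Complex.I_ne_zero hu.symm))
  have ev : v'' = (artinSymbol (galFrob K (rayClassField K ⊤)) δ.ideal)⁻¹ y' := by
    refine Subtype.ext (hinj ?_)
    rw [hv]
    linear_combination (-(algClosureEmb ι ((artinSymbol (galFrob K (rayClassField K ⊤)) δ.ideal)⁻¹ y'))) *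
      Complex.I_sq
  have key : (artinSymbol (galFrob K (rayClassField K ⊤)) δ'.ideal)⁻¹ =
      artinSymbol (galFrob K (rayClassField K ⊤)) J *
        (artinSymbol (galFrob K (rayClassField K ⊤)) δ.ideal)⁻¹ := by
    rw [hσ, mul_inv_rev, inv_inv, mul_comm]
  rw [e', key, eu, ev, AlgEquiv.mul_apply, AlgEquiv.mul_apply]

end MockHeegner

end Literature.NumberTheory.EllipticCurves.Monsky1990

end
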